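import Mathlib
import Summits.Ventures.LatticeQCDFlow.TrivializingMaps.WitnessNearestNeighbour
import Summits.Ventures.LatticeQCDFlow.Scaling.SUNCrossCutFloor
import HarnessLib

/-!
# (O3)-SIZE — the nearest-neighbour slice covariance of the plaquette has a VOLUME-UNIFORM floor
# at strong coupling: the dock of row 30's cross-cut floor to THEORY-1's column `sliceCov`

HONEST FRAMING: exact (Metropolis-corrected) sampling algorithms for lattice gauge theory; figures of
merit are autocorrelation/cost numbers at stated couplings and volumes; no continuum-physics claim.

Venture `LatticeQCDFlow` (cell pub-lqcd), topic `TrivializingMaps`, THEORY-1 §43 (GEN-89; HOME tier,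
no custody slot).  THEORY-1's research ledger had ONE open cell after §39 (THEOREM P,
`WitnessColumn.plaqRe_sliceCov_one_pos`: `K_p(1) = Cov_β(Re tr U_p, Re tr U_{p+e₀}) > 0` for
`β > 0`, even `L`, with a constant carrying `e^{−3βn·#plaq}`): **(O3)-size** — a floor under `K_p(1)`
that does NOT degrade with the volume.  That floor is ALREADY IN THE TREE in the language of
THEORY-2's hypothesis (U′): FANOUT row 30 (lean-1) proved
`Theory2.GroupLayer.crossCutCorrelatorFloor_sun` — for `SU(N)`, `N ≥ 2`, fundamental `Re tr`, every
`d`, `i < j`, `a ∉ {i, j}` and every `R` there is ONE `β₀ > 0` such that for every real `β ≠ 0` with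
`|β| ≤ β₀` the venture's `Conjectures.CrossCutCorrelatorFloor d N SU(N) ρ β R i j a` holds: some
`δ > 0` and `L₀` with `δ ≤ |⟨P_x P_{x+(2R+1)e_a}⟩_β − ⟨P_x⟩_β⟨P_{x+(2R+1)e_a}⟩_β|` for ALL torus sides
`L ≥ L₀` and all sites `x` (slab-chain proof of the leading tube `2^{-(4t+1)} N^{-4t} β^{4t}`,
`Scaling/GroupCrossCutFloorAllT`, `Scaling/SUNOneLink`, over theory-2 items 120/121
`Scaling/TruncatedCorrelatorFloor`, `Scaling/CrossCutFloorOfLeadingCoeff` and the Literature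
polymer expansion `PlaqSystemClusterExpansion` / `UniformTorusClusteringProofs`
[cite: OsterwalderSeilerAnnPhys1978, Thm. 3.5], [cite: MontvayMunster1994, §3.6.2 (3.437)]).
This file is the few-line DOCK at `a = 0` (THEORY-1's time axis), `R = 0` (separation `1`):
* `fundamentalRep_eq_defRep` — the two names of the defining representation agree (`rfl`);
* `sliceCov_plaqRe_one_eq` — kinematics: `sliceCov ρ β (Re tr ρ(U_{(x;i,j)})) 1` IS the truncated
  pair of (U′) at separation `2·0+1` along axis `0` (`WitnessColumn.timeTranslate_one_plaqRe`);
* `plaqRe_sliceCov_one_floor_uniform` — **(O3)-size, unsigned**: `n ≥ 2`, `0 < i < j`: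
  `∃ β₀ > 0, ∀ β ≠ 0, |β| ≤ β₀ → ∃ δ > 0, ∃ L₀, ∀ L ≥ L₀, ∀ x, δ ≤ |K_{(x;i,j)}(1)|` — every site,
  every torus side `≥ L₀`, NO parity condition, both signs of `β`;
* `plaqRe_sliceCov_one_floor_uniform_pos` — **(O3)-size, signed** (with THEOREM P): for
  `0 < β ≤ β₀`, even `L ≥ L₀` and `x` in the slice `x₀ = 0`: `δ ≤ K_{(x;i,j)}(1)`; hence the
  one-step effective mass `m₁ = −log(K_p(1)/K_p(0)) ≤ log(K_p(0)/δ) ≤ log(n²/δ)` uniformly in `L`.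
What is NOT claimed: the value of `β₀` or `δ` (inside row 30's proof `δ(β) = ½·2^{-5}n^{-4}β⁴`,
`n ≥ 3`, `= ½·2^{-4}β⁴` for `SU(2)`; not exported by (U′)'s `∃ δ`); anything at `|β| > β₀`
(intermediate coupling is the numerics' domain, not a theorem); `t ≥ 2` in the `sliceCov` format
(row 30 has every `R`; the dock is the same three lines with `R` in place of `0` and is left to a seat
that needs it).  LITERATURE GRADE (honest): nothing new — a definitional identification; the
mathematics is row 30's and [cite: OsterwalderSeilerAnnPhys1978], [cite: Schor1984, Thm 3.1–3.2].
Elementary given the imports; no `sorry`, no new `def`.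
-/

namespace Summit.Ventures.LatticeQCDFlow.TrivializingMaps

namespace WitnessColumn

open MeasureTheory Matrix
open Literature.MathematicalPhysics.QuantumFieldTheory
open Literature.MathematicalPhysics.QuantumLattice (fundamentalRep)

section Kinematics

variable {d L : ℕ} [NeZero d] [NeZero L] {G : Type*} [Group G] [TopologicalSpace G]
  [IsTopologicalGroup G] [CompactSpace G] [MeasurableSpace G] [BorelSpace G] {N : ℕ}
  (ρ : G →* Matrix (Fin N) (Fin N) ℂ)

/-- **Kinematics of the dock.** The nearest-neighbour slice covariance of `Re tr ρ(U_{(x;i,j)})` is the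
truncated pair expectation of (U′) at separation `2·0+1` along the axis `0`. [folklore] -/
theorem sliceCov_plaqRe_one_eq (β : ℝ) (x : Site d L) {i j : Fin d} (hij : i < j) :
    sliceCov ρ β (fun V : GaugeConfig d L G => WilsonRP.plaqRe ρ V (x, ⟨(i, j), hij⟩)) 1
      = wilsonExpectation (d := d) (L := L) ρ β
            (fun U => (ρ (plaquetteHolonomy U x i j)).trace.re *
              (ρ (plaquetteHolonomy U (x + Pi.single (0 : Fin d) ((2 * 0 + 1 : ℕ) : ZMod L))
                i j)).trace.re) -
          wilsonExpectation (d := d) (L := L) ρ β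
              (fun U => (ρ (plaquetteHolonomy U x i j)).trace.re) *
            wilsonExpectation (d := d) (L := L) ρ β
              (fun U => (ρ (plaquetteHolonomy U (x + Pi.single (0 : Fin d) ((2 * 0 + 1 : ℕ) : ZMod L))
                i j)).trace.re) := by
  have hc : (((2 * 0 + 1 : ℕ) : ZMod L)) = 1 := by norm_num
  have hs : x.shift 0 = x + Pi.single (0 : Fin d) (1 : ZMod L) := rfl
  simp only [sliceCov, wilsonExpectation, timeTranslate_one_plaqRe]
  simp only [WilsonRP.plaqRe, hc, hs]

end Kinematics

section SUnSize

variable {d n : ℕ} [NeZero d]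

/-- The two names of the defining representation `SU(n) ↪ M_n(ℂ)` in the tree agree. [folklore] -/
theorem fundamentalRep_eq_defRep : fundamentalRep (Fin n) = StrongCoupling.defRep n := rfl

/-- **(O3)-SIZE AT STRONG COUPLING, UNSIGNED — the volume-uniform floor on `|K_p(1)|`.**  Lattice
`SU(n)`, defining representation, `n ≥ 2`, a plaquette orientation `0 < i < j` (so `d ≥ 3`): there is
`β₀ > 0` such that for every real `β ≠ 0` with `|β| ≤ β₀` some `δ > 0` and `L₀` satisfy
`δ ≤ |sliceCov ρ₀ β (Re tr U_{(x;i,j)}) 1|` for EVERY torus side `L ≥ L₀` and EVERY site `x`.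
Dock of `Theory2.GroupLayer.crossCutCorrelatorFloor_sun` (row 30) at `a = 0`, `R = 0`. [folklore] -/
theorem plaqRe_sliceCov_one_floor_uniform (hn : 2 ≤ n) {i j : Fin d} (hij : i < j) (hi : 0 < i) :
    ∃ β₀ : ℝ, 0 < β₀ ∧ ∀ β : ℝ, β ≠ 0 → |β| ≤ β₀ →
      ∃ δ : ℝ, 0 < δ ∧ ∃ L₀ : ℕ, ∀ (L : ℕ) [NeZero L], L₀ ≤ L → ∀ x : Site d L,
        δ ≤ |sliceCov (StrongCoupling.defRep n) β
              (fun V : GaugeConfig d L (specialUnitaryGroup (Fin n) ℂ) =>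
                WilsonRP.plaqRe (StrongCoupling.defRep n) V (x, ⟨(i, j), hij⟩)) 1| := by
  have hai : (0 : Fin d) ≠ i := hi.ne
  have haj : (0 : Fin d) ≠ j := (hi.trans hij).ne
  obtain ⟨β₀, hβ₀, h⟩ :=
    Theory2.GroupLayer.crossCutCorrelatorFloor_sun (d := d) (a := (0 : Fin d)) hn hij hai haj 0
  refine ⟨β₀, hβ₀, fun β hβ hle => ?_⟩
  have h' := h β hβ hle
  dsimp only [Conjectures.CrossCutCorrelatorFloor] at h'
  obtain ⟨δ, hδ, L₀, hL⟩ := h'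
  refine ⟨δ, hδ, L₀, fun L _ hL₀ x => ?_⟩
  have key := hL L hL₀ x
  rw [fundamentalRep_eq_defRep] at key
  rw [sliceCov_plaqRe_one_eq]
  exact key

/-- **(O3)-SIZE AT STRONG COUPLING, SIGNED — with THEOREM P.**  For `0 < β ≤ β₀`, even torus sides
`L ≥ L₀` and a spatial plaquette `p = (x; i, j)` of the slice `x₀ = 0` (`0 < i < j`):
`δ ≤ K_p(1) = sliceCov ρ₀ β (Re tr U_p) 1`, `δ = δ(β) > 0` independent of `L` and `x`. [folklore] -/
theorem plaqRe_sliceCov_one_floor_uniform_pos (hn : 2 ≤ n) {i j : Fin d} (hij : i < j) (hi : 0 < i) :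
    ∃ β₀ : ℝ, 0 < β₀ ∧ ∀ β : ℝ, 0 < β → β ≤ β₀ →
      ∃ δ : ℝ, 0 < δ ∧ ∃ L₀ : ℕ, ∀ (L : ℕ) [NeZero L], Even L → L₀ ≤ L → ∀ x : Site d L, x 0 = 0 →
        δ ≤ sliceCov (StrongCoupling.defRep n) β
              (fun V : GaugeConfig d L (specialUnitaryGroup (Fin n) ℂ) =>
                WilsonRP.plaqRe (StrongCoupling.defRep n) V (x, ⟨(i, j), hij⟩)) 1 := by
  obtain ⟨β₀, hβ₀, h⟩ := plaqRe_sliceCov_one_floor_uniform (d := d) hn hij hi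
  refine ⟨β₀, hβ₀, fun β hβ hle => ?_⟩
  obtain ⟨δ, hδ, L₀, hL⟩ := h β hβ.ne' (by rwa [abs_of_pos hβ])
  refine ⟨δ, hδ, L₀, fun L _ hev hL₀ x hx => ?_⟩
  have key := hL L hL₀ x
  have hpos := plaqRe_sliceCov_one_pos (d := d) hev hn hβ (x, ⟨(i, j), hij⟩) hx hi
  rwa [abs_of_pos hpos] at key

end SUnSize

end WitnessColumn

end Summit.Ventures.LatticeQCDFlow.TrivializingMaps
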